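import Mathlib
import HarnessLib
import Literature.MathematicalPhysics.QuantumFieldTheory.ConstructiveQFTWave0
import Summits.Ventures.LatticeQCDFlow.Scaling.SparsePatchSectors
import Summits.Ventures.LatticeQCDFlow.Scaling.SpecialUnitaryLocalPaths
import Summits.Ventures.LatticeQCDFlow.Scaling.MetricTunnellingUN
import Summits.Ventures.LatticeQCDFlow.Scaling.LatticePeeling

/-!
# LatticeQCDFlow / Scaling — the SPARSE-PATCH tunnelling law on the lattice: single-link updates and sweeps for `SU(N)` and `U(N)` (v3.2)

LANDING NOTE (lean-1 GEN-5, custody): theory-2's item 83 (432 lines) is split at the gate's 400-line limit —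
this file keeps §§1–3 (slots, bi-invariant control, the generic laws); §§4–5 (the `SU(N)` / `U(N)` instances
`SUN.…`, `UN.…` described below) are the companion file `Scaling/SparsePatchSectorsLatticeGroups.lean`, all
declarations verbatim.

HONEST FRAMING: exact (Metropolis-corrected) sampling algorithms for lattice gauge theory; figures
of merit are autocorrelation/cost numbers at stated couplings and volumes; no continuum-physics
claim.

THEORY-2.md §3.3 / conjecture C7(b), LATTICE PART.  `Scaling/SparsePatchSectors.lean` proves the
abstract sparse-patch law.  Here the plaquette defects are the Wilson ones on the periodic torus
`(ℤ/L)^d`, `a_p(U) = dist (U_p, 1)` (per-link Hilbert–Schmidt metric, `U_p` the plaquette holonomy of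
`Literature…ConstructiveQFTWave0`; the admissible region `{∀ p, a_p < ε}` has Lüscher's topological sectors as
its connected components for `ε ≤ ε_N` [cite: Luscher1982Topology] — his theorem LABELS the components, the law
below does not use it), for a matrix group `G` with a bi-invariant metric:

* `plaqSlot p : Fin 4 → Edge d L` — the four links of `p = (x; i<j)` in holonomy order (the one `def`);
* `dist_plaquetteHolonomy_one_le` — linkwise control `a_p(V) ≤ a_p(U) + Σ_s dist(U_{slot s}, V_{slot s})`;
* `plaqSlot_injective` — for `L ≥ 2` the four slots are distinct links, so a SINGLE LINK is a
  plaquette-sparse patch; `exists_plaqSlot_detect` — for `d ≥ 2` every link is read off by a plaquette;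
* **`compProd_sector_ne_le_of_sparseLinks`** (generic `G`, local paths of radii `(ρ, r)` as a
  hypothesis), **`compProd_sector_ne_le_of_singleLink`**, **`measure_sector_ne_le_nsteps_of_linkSweep`**;
* **`SUN.compProd_sector_ne_le_of_sparseLinks` / `…_of_singleLink` / `SUN.measure_sector_ne_le_nsteps_of_linkSweep`**
  — `G = SU(N)`: there is `r₀ = r₀(N) > 0` (lean-1's local-path radius; NO dependence on `d`, `L`, `β`,
  `ε`) such that for every `0 ≤ c` with `2c ≤ r₀`, `3c ≤ ε`, every `d ≥ 2`, `L ≥ 2`: an EXACT sampler for ANY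
  law `μ` on `SU(N)^E` that updates one link per step (heat bath, overrelaxation, link-Metropolis, any
  proposal + filter) changes the admissibility-`ε` SECTOR with stationary probability
  `≤ 2·μ{some plaquette containing the link has a_p ≥ c}` per step, and `≤ n·2·max_k(…)` per sweep of `n`
  link updates; sparse parallel link sets likewise;
* **`UN.…`** — `G = U(N)` with the EXPLICIT threshold: every `0 ≤ c ≤ 1/16` with `5c ≤ ε`.

With `μ` the Wilson measure at coupling `β` the right side is `2·(# plaquettes at the link)·μ{a_p ≥ c}`,
a one-plaquette THIN-PLAQUETTE tail — the patch analogue of the small-step law's `μ(cthickening r D)`: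
topology can move under local updates only through plaquettes far from the identity AT THE UPDATED LINK.
General (non-sparse) patches — e.g. a `2^4` block update — are NOT covered (C7(b′), open: the large
plaquette may sit on a hybrid configuration).  No sorry, no new axioms; one `def` (`plaqSlot`).
-/

noncomputable section

open scoped Matrix.Norms.Frobenius ENNReal ProbabilityTheory
open MeasureTheory ProbabilityTheory Metric Set
open Literature.MathematicalPhysics.QuantumFieldTheory
open Summit.Ventures.LatticeQCDFlow.Theory2.Tunnelling

namespace Summit.Ventures.LatticeQCDFlow.Theory2.Lattice

variable {d L : ℕ}

/-! ## §1. Plaquette slots -/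

/-- The four links of the plaquette `p = (x; i < j)` in the order of the holonomy
`U(x,i) U(x+eᵢ,j) U(x+eⱼ,i)⁻¹ U(x,j)⁻¹`. [folklore] -/
def plaqSlot (p : Plaquette d L) : Fin 4 → Edge d L :=
  ![(p.1, p.2.1.1), (p.1.shift p.2.1.1, p.2.1.2), (p.1.shift p.2.1.2, p.2.1.1), (p.1, p.2.1.2)]

/-- Slot `0` is the first link `(x, i)`. [folklore] -/
@[simp] theorem plaqSlot_zero (p : Plaquette d L) : plaqSlot p 0 = (p.1, p.2.1.1) := rfl
/-- Slot `1` is the second link `(x + eᵢ, j)`. [folklore] -/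
@[simp] theorem plaqSlot_one (p : Plaquette d L) : plaqSlot p 1 = (p.1.shift p.2.1.1, p.2.1.2) := rfl
/-- Slot `2` is the third link `(x + eⱼ, i)` (entering inverted). [folklore] -/
@[simp] theorem plaqSlot_two (p : Plaquette d L) : plaqSlot p 2 = (p.1.shift p.2.1.2, p.2.1.1) := rfl
/-- Slot `3` is the fourth link `(x, j)` (entering inverted). [folklore] -/
@[simp] theorem plaqSlot_three (p : Plaquette d L) : plaqSlot p 3 = (p.1, p.2.1.2) := rfl

/-- For `L ≥ 2` the four slots of a plaquette are four different links. [folklore] -/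
theorem plaqSlot_injective [NeZero L] (hL : 2 ≤ L) (p : Plaquette d L) :
    Function.Injective (plaqSlot p) := by
  obtain ⟨x, ⟨⟨i, j⟩, hij⟩⟩ := p
  have hij' : i ≠ j := ne_of_lt hij
  have h1 : x.shift i ≠ x := shift_ne_self hL x i
  have h2 : x.shift j ≠ x := shift_ne_self hL x j
  intro s s' h
  fin_cases s <;> fin_cases s' <;>
    simp only [plaqSlot, Fin.zero_eta, Fin.mk_one, Fin.reduceFinMk, Matrix.cons_val_zero,
      Matrix.cons_val_one, Matrix.cons_val, Prod.mk.injEq] at h ⊢ <;>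
    first
      | rfl
      | exact absurd h.2 hij'
      | exact absurd h.2.symm hij'
      | exact absurd h.1 h1
      | exact absurd h.1.symm h1
      | exact absurd h.1 h2
      | exact absurd h.1.symm h2

/-- A single link is a plaquette-sparse patch (`L ≥ 2`). [folklore] -/
theorem plaqSlot_sparse_singleton [NeZero L] (hL : 2 ≤ L) (e₀ : Edge d L) :
    ∀ (p : Plaquette d L) (s s' : Fin 4), plaqSlot p s ∈ ({e₀} : Set (Edge d L)) →
      plaqSlot p s' ∈ ({e₀} : Set (Edge d L)) → s = s' :=
  fun p _ _ hs hs' => plaqSlot_injective hL p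
    ((Set.mem_singleton_iff.mp hs).trans (Set.mem_singleton_iff.mp hs').symm)

/-! ## §2. Linkwise control and detectability for a bi-invariant metric -/

section Generic

variable {G : Type*} [Group G] [PseudoMetricSpace G]

/-- Inversion is an isometry for a bi-invariant metric. [folklore] -/
theorem dist_inv_inv_of_biInvariant (hl : ∀ a b c : G, dist (a * b) (a * c) = dist b c)
    (hr : ∀ a b c : G, dist (a * c) (b * c) = dist a b) (a b : G) : dist a⁻¹ b⁻¹ = dist a b := by
  have e1 := hl a a⁻¹ b⁻¹
  rw [mul_inv_cancel] at e1
  have e2 := hr 1 (a * b⁻¹) b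
  rw [one_mul, inv_mul_cancel_right] at e2
  rw [← e1, ← e2, dist_comm]

/-- Products move by at most the sum of the moves of the factors. [folklore] -/
theorem dist_mul_mul_le_of_biInvariant (hl : ∀ a b c : G, dist (a * b) (a * c) = dist b c)
    (hr : ∀ a b c : G, dist (a * c) (b * c) = dist a b) (a b a' b' : G) :
    dist (a * b) (a' * b') ≤ dist a a' + dist b b' := by
  calc dist (a * b) (a' * b') ≤ dist (a * b) (a * b') + dist (a * b') (a' * b') := dist_triangle _ _ _
    _ = dist a a' + dist b b' := by rw [hl, hr, add_comm]

/-- **Linkwise control of the Wilson defect**: `dist (V_p, 1) ≤ dist (U_p, 1) + Σ_s dist (U_{slot s}, V_{slot s})`.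
[folklore] -/
theorem dist_plaquetteHolonomy_one_le (hl : ∀ a b c : G, dist (a * b) (a * c) = dist b c)
    (hr : ∀ a b c : G, dist (a * c) (b * c) = dist a b) (p : Plaquette d L) (U V : GaugeConfig d L G) :
    dist (plaquetteHolonomy V p.1 p.2.1.1 p.2.1.2) 1 ≤ dist (plaquetteHolonomy U p.1 p.2.1.1 p.2.1.2) 1 +
      ∑ s, dist (U (plaqSlot p s)) (V (plaqSlot p s)) := by
  have hm := dist_mul_mul_le_of_biInvariant hl hr
  have hi := dist_inv_inv_of_biInvariant hl hr
  have h4 : dist (plaquetteHolonomy U p.1 p.2.1.1 p.2.1.2) (plaquetteHolonomy V p.1 p.2.1.1 p.2.1.2) ≤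
      ∑ s, dist (U (plaqSlot p s)) (V (plaqSlot p s)) := by
    rw [Fin.sum_univ_four, plaqSlot_zero, plaqSlot_one, plaqSlot_two, plaqSlot_three]
    unfold plaquetteHolonomy
    have e1 := hm (U (p.1, p.2.1.1) * U (p.1.shift p.2.1.1, p.2.1.2) * (U (p.1.shift p.2.1.2, p.2.1.1))⁻¹)
      (U (p.1, p.2.1.2))⁻¹ (V (p.1, p.2.1.1) * V (p.1.shift p.2.1.1, p.2.1.2) * (V (p.1.shift p.2.1.2, p.2.1.1))⁻¹)
      (V (p.1, p.2.1.2))⁻¹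
    have e2 := hm (U (p.1, p.2.1.1) * U (p.1.shift p.2.1.1, p.2.1.2)) (U (p.1.shift p.2.1.2, p.2.1.1))⁻¹
      (V (p.1, p.2.1.1) * V (p.1.shift p.2.1.1, p.2.1.2)) (V (p.1.shift p.2.1.2, p.2.1.1))⁻¹
    have e3 := hm (U (p.1, p.2.1.1)) (U (p.1.shift p.2.1.1, p.2.1.2)) (V (p.1, p.2.1.1))
      (V (p.1.shift p.2.1.1, p.2.1.2))
    rw [hi] at e1 e2
    linarith
  calc dist (plaquetteHolonomy V p.1 p.2.1.1 p.2.1.2) 1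
      ≤ dist (plaquetteHolonomy V p.1 p.2.1.1 p.2.1.2) (plaquetteHolonomy U p.1 p.2.1.1 p.2.1.2) +
          dist (plaquetteHolonomy U p.1 p.2.1.1 p.2.1.2) 1 := dist_triangle _ _ _
    _ ≤ _ := by rw [dist_comm]; linarith

/-- **Detectability** (`d ≥ 2`): every link `e = (x, k)` is a slot `s` of a plaquette `p` (in a plane
`(k, j)` or `(j, k)`, `j ≠ k`) such that, when the other three slots are frozen, the displacement of the
link is read off by the plaquette: `dist (U_e, V_e) = dist (U_p, V_p) ≤ dist (U_p, 1) + dist (V_p, 1)`.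
[folklore] -/
theorem exists_plaqSlot_detect (hd : 2 ≤ d) (hl : ∀ a b c : G, dist (a * b) (a * c) = dist b c)
    (hr : ∀ a b c : G, dist (a * c) (b * c) = dist a b) (e : Edge d L) :
    ∃ (p : Plaquette d L) (s : Fin 4), plaqSlot p s = e ∧ ∀ U V : GaugeConfig d L G,
      (∀ s', s' ≠ s → U (plaqSlot p s') = V (plaqSlot p s')) →
        dist (U e) (V e) ≤ dist (plaquetteHolonomy U p.1 p.2.1.1 p.2.1.2) 1 +
          dist (plaquetteHolonomy V p.1 p.2.1.1 p.2.1.2) 1 := by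
  obtain ⟨x, k⟩ := e
  obtain ⟨j, hj⟩ : ∃ j : Fin d, j ≠ k := by
    by_cases hk : (k : ℕ) = 0
    · exact ⟨⟨1, by omega⟩, Fin.ne_of_val_ne (by simp only; omega)⟩
    · exact ⟨⟨0, by omega⟩, Fin.ne_of_val_ne (by simp only; omega)⟩
  have hi := dist_inv_inv_of_biInvariant hl hr
  rcases lt_or_gt_of_ne hj with hjk | hkj
  · -- plane `(j, k)`, slot 3: `U_p = M · U_e⁻¹`
    refine ⟨(x, ⟨(j, k), hjk⟩), 3, rfl, fun U V hUV => ?_⟩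
    have h0 := hUV 0 (by decide)
    have h1 := hUV 1 (by decide)
    have h2 := hUV 2 (by decide)
    simp only [plaqSlot_zero, plaqSlot_one, plaqSlot_two] at h0 h1 h2
    have he : dist (U (x, k)) (V (x, k)) =
        dist (plaquetteHolonomy U x j k) (plaquetteHolonomy V x j k) := by
      unfold plaquetteHolonomy
      rw [← h0, ← h1, ← h2, hl, hi]
    calc dist (U (x, k)) (V (x, k)) = _ := he
      _ ≤ dist (plaquetteHolonomy U x j k) 1 + dist 1 (plaquetteHolonomy V x j k) := dist_triangle _ _ _
      _ = _ := by rw [dist_comm (1 : G)]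
  · -- plane `(k, j)`, slot 0: `U_p = U_e · M`
    refine ⟨(x, ⟨(k, j), hkj⟩), 0, rfl, fun U V hUV => ?_⟩
    have h1 := hUV 1 (by decide)
    have h2 := hUV 2 (by decide)
    have h3 := hUV 3 (by decide)
    simp only [plaqSlot_one, plaqSlot_two, plaqSlot_three] at h1 h2 h3
    have he : dist (U (x, k)) (V (x, k)) =
        dist (plaquetteHolonomy U x k j) (plaquetteHolonomy V x k j) := by
      unfold plaquetteHolonomy
      rw [← h1, ← h2, ← h3, hr, hr, hr]
    calc dist (U (x, k)) (V (x, k)) = _ := he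
      _ ≤ dist (plaquetteHolonomy U x k j) 1 + dist 1 (plaquetteHolonomy V x k j) := dist_triangle _ _ _
      _ = _ := by rw [dist_comm (1 : G)]

/-! ## §3. The lattice laws for a generic `G` (local paths as a hypothesis) -/

variable [MeasurableSpace G]

/-- **Sparse-links tunnelling law** (generic `G` with a bi-invariant metric and `(ρ, r)`-local paths;
`d ≥ 2`; `Λ` plaquette-sparse; `2c ≤ ρ`, `c + r ≤ ε`): an exact sampler updating only the links of `Λ`
changes the admissibility-`ε` sector with stationary one-step probability
`≤ 2·μ{∃ p with a slot in Λ, dist (U_p, 1) ≥ c}`. [folklore] -/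
theorem compProd_sector_ne_le_of_sparseLinks (hd : 2 ≤ d)
    (hl : ∀ a b c : G, dist (a * b) (a * c) = dist b c) (hr : ∀ a b c : G, dist (a * c) (b * c) = dist a b)
    {ρ r : ℝ} (hr0 : 0 ≤ r)
    (hpath : ∀ g g' : G, dist g g' ≤ ρ → ∃ γ : ℝ → G, ContinuousOn γ (Icc (0 : ℝ) 1) ∧ γ 0 = g ∧
      γ 1 = g' ∧ ∀ t ∈ Icc (0 : ℝ) 1, dist (γ t) g ≤ r)
    {c ε : ℝ} (hcρ : 2 * c ≤ ρ) (hcr : c + r ≤ ε) {Λ : Set (Edge d L)}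
    (hΛ : ∀ (p : Plaquette d L) (s s' : Fin 4), plaqSlot p s ∈ Λ → plaqSlot p s' ∈ Λ → s = s')
    (μ : Measure (GaugeConfig d L G)) [SFinite μ]
    (κ : Kernel (GaugeConfig d L G) (GaugeConfig d L G)) [IsMarkovKernel κ] (hinv : κ.Invariant μ)
    (hmove : ∀ᵐ q ∂(μ ⊗ₘ κ), ∀ e ∉ Λ, q.1 e = q.2 e) :
    (μ ⊗ₘ κ) {q | connectedComponentIn
          {W : GaugeConfig d L G | ∀ p : Plaquette d L, dist (plaquetteHolonomy W p.1 p.2.1.1 p.2.1.2) 1 < ε} q.1 ≠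
        connectedComponentIn
          {W : GaugeConfig d L G | ∀ p : Plaquette d L, dist (plaquetteHolonomy W p.1 p.2.1.1 p.2.1.2) 1 < ε} q.2} ≤
      2 * μ {U | ∃ (p : Plaquette d L) (s : Fin 4), plaqSlot p s ∈ Λ ∧
        c ≤ dist (plaquetteHolonomy U p.1 p.2.1.1 p.2.1.2) 1} :=
  compProd_sector_ne_le_of_sparsePatch
    (a := fun (p : Plaquette d L) (W : GaugeConfig d L G) => dist (plaquetteHolonomy W p.1 p.2.1.1 p.2.1.2) 1)
    (slot := plaqSlot) (dist_plaquetteHolonomy_one_le hl hr) hΛ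
    (fun e _ => exists_plaqSlot_detect hd hl hr e) hr0 hpath hcρ hcr μ κ hinv hmove

/-- **Single-link tunnelling law** (`d ≥ 2`, `L ≥ 2`): an exact sampler updating one link `e₀` per step
changes the sector with stationary probability `≤ 2·μ{some plaquette containing e₀ has dist (U_p, 1) ≥ c}`.
[folklore] -/
theorem compProd_sector_ne_le_of_singleLink [NeZero L] (hd : 2 ≤ d) (hL : 2 ≤ L)
    (hl : ∀ a b c : G, dist (a * b) (a * c) = dist b c) (hr : ∀ a b c : G, dist (a * c) (b * c) = dist a b)
    {ρ r : ℝ} (hr0 : 0 ≤ r)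
    (hpath : ∀ g g' : G, dist g g' ≤ ρ → ∃ γ : ℝ → G, ContinuousOn γ (Icc (0 : ℝ) 1) ∧ γ 0 = g ∧
      γ 1 = g' ∧ ∀ t ∈ Icc (0 : ℝ) 1, dist (γ t) g ≤ r)
    {c ε : ℝ} (hcρ : 2 * c ≤ ρ) (hcr : c + r ≤ ε) (e₀ : Edge d L)
    (μ : Measure (GaugeConfig d L G)) [SFinite μ]
    (κ : Kernel (GaugeConfig d L G) (GaugeConfig d L G)) [IsMarkovKernel κ] (hinv : κ.Invariant μ)
    (hmove : ∀ᵐ q ∂(μ ⊗ₘ κ), ∀ e, e ≠ e₀ → q.1 e = q.2 e) :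
    (μ ⊗ₘ κ) {q | connectedComponentIn
          {W : GaugeConfig d L G | ∀ p : Plaquette d L, dist (plaquetteHolonomy W p.1 p.2.1.1 p.2.1.2) 1 < ε} q.1 ≠
        connectedComponentIn
          {W : GaugeConfig d L G | ∀ p : Plaquette d L, dist (plaquetteHolonomy W p.1 p.2.1.1 p.2.1.2) 1 < ε} q.2} ≤
      2 * μ {U | ∃ (p : Plaquette d L) (s : Fin 4), plaqSlot p s = e₀ ∧
        c ≤ dist (plaquetteHolonomy U p.1 p.2.1.1 p.2.1.2) 1} := by
  have h := compProd_sector_ne_le_of_sparseLinks hd hl hr hr0 hpath hcρ hcr (plaqSlot_sparse_singleton hL e₀)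
    μ κ hinv (by filter_upwards [hmove] with q hq e he; exact hq e he)
  simpa only [Set.mem_singleton_iff] using h

/-- **Link-sweep law** (`d ≥ 2`, `L ≥ 2`): a process on `G^E` with all one-time marginals `m` whose `k`-th
step changes only the link `e k` (a sweep, in any order, of single-link exact updates in stationarity)
changes its sector over `n` steps with probability `≤ n·2·M`, `M ≥ m{some plaquette containing e k has
dist (U_p, 1) ≥ c}` for all `k`. [folklore] -/
theorem measure_sector_ne_le_nsteps_of_linkSweep [NeZero L] (hd : 2 ≤ d) (hL : 2 ≤ L)
    (hl : ∀ a b c : G, dist (a * b) (a * c) = dist b c) (hr : ∀ a b c : G, dist (a * c) (b * c) = dist a b)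
    {ρ r : ℝ} (hr0 : 0 ≤ r)
    (hpath : ∀ g g' : G, dist g g' ≤ ρ → ∃ γ : ℝ → G, ContinuousOn γ (Icc (0 : ℝ) 1) ∧ γ 0 = g ∧
      γ 1 = g' ∧ ∀ t ∈ Icc (0 : ℝ) 1, dist (γ t) g ≤ r)
    {c ε : ℝ} (hcρ : 2 * c ≤ ρ) (hcr : c + r ≤ ε) (e : ℕ → Edge d L)
    {Ω : Type*} [MeasurableSpace Ω] (P : Measure Ω) (Z : ℕ → Ω → GaugeConfig d L G)
    (hZ : ∀ k, Measurable (Z k)) (m : Measure (GaugeConfig d L G)) (hmarg : ∀ k, P.map (Z k) = m)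
    (hstep : ∀ k, ∀ᵐ ω ∂P, ∀ e', e' ≠ e k → Z k ω e' = Z (k + 1) ω e') {M : ℝ≥0∞}
    (hM : ∀ k, m {U | ∃ (p : Plaquette d L) (s : Fin 4), plaqSlot p s = e k ∧
      c ≤ dist (plaquetteHolonomy U p.1 p.2.1.1 p.2.1.2) 1} ≤ M) (n : ℕ) :
    P {ω | connectedComponentIn
          {W : GaugeConfig d L G | ∀ p : Plaquette d L, dist (plaquetteHolonomy W p.1 p.2.1.1 p.2.1.2) 1 < ε} (Z n ω) ≠
        connectedComponentIn
          {W : GaugeConfig d L G | ∀ p : Plaquette d L, dist (plaquetteHolonomy W p.1 p.2.1.1 p.2.1.2) 1 < ε} (Z 0 ω)} ≤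
      n * (2 * M) := by
  have h := measure_sector_ne_le_nsteps_of_sparsePatches
    (a := fun (p : Plaquette d L) (W : GaugeConfig d L G) => dist (plaquetteHolonomy W p.1 p.2.1.1 p.2.1.2) 1)
    (slot := plaqSlot) (Λ := fun k => ({e k} : Set (Edge d L))) (dist_plaquetteHolonomy_one_le hl hr)
    (fun k => plaqSlot_sparse_singleton hL (e k)) (fun k e' _ => exists_plaqSlot_detect hd hl hr e') hr0 hpath
    hcρ hcr P Z hZ m hmarg (fun k => by filter_upwards [hstep k] with ω hω e' he'; exact hω e' he')
    (M := M) (fun k => by simpa only [Set.mem_singleton_iff] using hM k) n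
  simpa only [Set.mem_singleton_iff] using h

end Generic

end Summit.Ventures.LatticeQCDFlow.Theory2.Lattice
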